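import Literature.NumberTheory.EllipticCurves.KellerYin2024.PotentiallyGoodOrdinaryIwasawaTheory
import HarnessLib

/-!
# Keller–Yin (arXiv:2410.23241), Thm. 0.1.2 = Thm. 3.7.1 ON THE SCOPE OF ITS PRINTED PROOF
# (§3.1 Case (I), `p ∤ N′`): the narrowed twin of `thm012_…`, the uncovered remainder, and the
# kernel bookkeeping `as stated ⟺ Case (I) ∧ remainder` (UNREFEREED PREPRINT; nothing asserted)

HONEST FRAMING (cell `bsd-cited`, ARM P "cited-input referee programme", D-0088(2); typer seat
`bsd-cited-ty1`, reader of record `bsd-cited-r19`, sheet `pub/bsd-cited/sheets/D-AUDIT-r19.md`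
§D; typed ≠ proved ≠ endorsed). The sibling file `PotentiallyGoodOrdinaryPConverse.lean` vendors
T. Keller, M. Yin, *`p`-converse theorems for elliptic curves of potentially good ordinary reduction
at Eisenstein primes*, arXiv:2410.23241 **v1**, **Theorem 0.1.2 = Theorem 3.7.1** VERBATIM AS
STATED (`thm012_analyticRank_eq_of_selmerCorank_eq`: every prime `p > 2` of potentially good
ordinary reduction, `E[p]` reducible, `r ∈ {0,1}`: `corank_{ℤ_p} Sel_{p^∞}(E/ℚ) = r ⟹
ord_{s=1} L(E,s) = r`). The D-audit of that binder (verdict STRONGER-THAN-PROVED: statement =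
print's statement, print's proof ⊊ statement) found that EVERY input of the printed proof from
Thm. 3.3.5 on carries the hypothesis "`p ∤ N′`" = §3.1 **Case (I)** (store text
`paper:arxiv-2410.23241`, chunk:line): §3.1 p0013 L35–L37 "Case I: `f` is a potentially good
ordinary modular form of weight `2` for which `f̃` has good reduction … Case II: `f` potentially
multiplicative"; p0015 L8–L10 "(JLZmain) does not cover cases (II) … From now on, we assume
`p ∤ N′`"; Thm. 3.3.5 p0018 L10–L11 and Thm. 3.3.6 p0019 L8–L9 "Assume `p > 2` and that `p ∤ N′`";
Prop. 3.4.4 p0019 L57–L58 "`p ∤ N′`"; Thm. 3.5.1 (IMCpo) p0020 L23–L24 "Assume we are in Case (I)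
of (twists), i.e., `p ∤ N′`"; while the proof of Thm. 3.7.1 (p0021 L46–L48) is "By replacing the
appeal to (controlgo) (resp. (Hgstr), (IMC)) to (controlpo) (resp. (Hgstrpo), (IMCpo)), the rest of
the proof is exactly the same as that in (pCgo)". Here `f_E = f̃ ⊗ ε` with `f̃ ∈ S_2(Γ₀(N′), ε⁻²)`
`p`-ordinary (Thm. 3.1.1 = Nekovář, *Selmer complexes*, 12.11.5 (iv)).

## Dictionary "Case (I)" ↔ the tree (for an elliptic curve over `ℚ`, `p` odd)

`p ∤ N′` ⟺ `ρ_{E,ℓ}|_{I_p} ≅ ε|_{I_p} ⊕ ε|_{I_p}` is scalar of determinant `1`, i.e. `ε|_{I_p}`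
quadratic or trivial ⟺ semistability defect `e ∈ {1,2}` ⟺ `E` acquires good (ordinary) reduction
over an extension of `ℚ_p` of degree `≤ 2` ⟺ `E` or its quadratic twist `E^{(p*)}` has good ordinary
reduction at `p`. This is EXACTLY the tree predicate
`WeierstrassCurve.HasGoodOrdinaryReductionOverQuadraticAt W p` of the sibling
`PotentiallyGoodOrdinaryIwasawaTheory.lean` (cell `bsd-littype`, whose module docstring prints the
same dictionary and the same scope consequence), which implies
`W.HasPotentiallyGoodOrdinaryReductionAtPrime p`
(`WeierstrassCurve.hasPotentiallyGoodOrdinaryReductionAtPrime_of_overQuadratic`) and contains good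
ordinary reduction at `p` (`WeierstrassCurve.hasGoodOrdinaryReductionOverQuadraticAt_of_goodOrd`).
It is REUSED here by name (no new notion). The potentially good ordinary primes with `e ∈ {3,4,6}`
(then `p ≡ 1 (mod e)`, so `p ≥ 5`; `f̃` is `p`-new with nebentypus `ε⁻²` of conductor `p`) are in
the STATEMENT of Thm. 0.1.2 and in NEITHER of the paper's Cases (I)/(II): no line of the printed
proof addresses them (the input the paper itself names as missing there is the explicit
reciprocity law [JLZ21, Thm. B] = Prop. 3.1.2, stated for `p ∤ N′`). At `p = 3` potentially good
ORDINARY reduction forces `e ∈ {1,2}` (an inertial automorphism of order `3` or `4` of the good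
special fibre forces `j̃ = 0 = 1728`, supersingular in characteristic `3`), so the paper's `p = 3`
application Cor. 3.8.1 lies inside Case (I).

## What this file declares (D-0014 / D-0026 bookkeeping)

* `thm371_caseI_analyticRank_eq_of_selmerCorank_eq` — **the narrowed twin**: Thm. 3.7.1 on the
  scope of its printed proof = the binders of `thm012_…` with "potentially good ordinary at `p`"
  REPLACED by the stronger Case-(I) hypothesis `W.HasGoodOrdinaryReductionOverQuadraticAt p`. This
  is the statement a consumer who wants only what the printed proof supports should take as
  `(h : thm371_caseI_…)`. Claim-tagged (the proof is an unrefereed preprint resting on the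
  preprint [KY24] = arXiv:2402.12781 and on an in-proof generalisation of [JLZ21]); no `_holds`.
* `thm371_remainder_analyticRank_eq_of_selmerCorank_eq` — **the remainder**: the same conclusion at
  a potentially good ordinary `p > 2` that is NOT Case (I). CLAIMED by the statement of Thm. 0.1.2,
  covered by no line of its proof; an OPEN leaf with, on 2026-08-26, no consumer in `Summits/`
  (placement: `pub/ladder-directors/REQUESTS.md` R-02). Claim-tagged; never cite it as a theorem.
* PROVED (pure logic + the two tree bridges above): `thm012_iff_caseI_and_remainder`
  (`thm012_… ↔ twin ∧ remainder`), the pointed forms `thm371_caseI_of_thm012`,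
  `thm371_remainder_of_thm012`, `thm012_of_caseI_of_remainder`, and the twin's consumer API
  mirroring the sibling file's (`rank_eq_and_finite_sha_of_thm371_caseI`, `…_of_goodOrd`,
  `…_of_good`, `thmE_one_of_thm371_caseI`, `thmE_zero_of_thm371_caseI`: the twin still contains
  Castella–Grossi–Lee–Skinner 2022 Thm. E, i.e. the narrowing loses nothing at good primes).
* PROVED, DEDUP (D-AUDIT-r19 ADDENDUM-2 §3): `thm371_caseI_iff_caseOne_OPEN` — the typing layer's
  spelling `thm371_pConverse_caseOne_OPEN` (sibling `PotentiallyGoodOrdinaryIwasawaTheory.lean` §7,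
  cell `bsd-littype`) is the narrowed twin BYTE FOR BYTE (`Iff.rfl`); the two names are ALIASES of
  one open statement. Consumers should cite `thm371_caseI_…` (it carries the remainder / iff
  bookkeeping and the consumer API); pointed forms `thm371_caseOne_OPEN_of_caseI`,
  `thm371_caseI_of_caseOne_OPEN`.

This file mints exactly TWO claim-tagged statements, both SLICES of the already-vendored claim
`thm012_…` (their conjunction is equivalent to it, proved below) — a binder NARROWING recorded by a
referee programme, not new mathematical debt; everything else is a proved theorem. It is a separate
module (not an in-file append) only because the Case-(I) predicate of record lives in
`PotentiallyGoodOrdinaryIwasawaTheory.lean`, which imports `PotentiallyGoodOrdinaryPConverse.lean`.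

## References
* [KellerYin2024PotOrd] T. Keller, M. Yin, arXiv:2410.23241v1 (2024): Thm. 0.1.2 = Thm. 3.7.1
  (statement p0003 L39–L45 = p0021 L39–L44; proof p0021 L46–L48), §3.1 (p0013 L28–L37, p0015
  L8–L10), Thm. 3.1.1, Prop. 3.1.2, Thms. 3.3.5/3.3.6, Prop. 3.4.4, Thm. 3.5.1, Thm. 3.6.1, Cor. 3.8.1.
* [KellerYin2024] T. Keller, M. Yin, arXiv:2402.12781 ([KY24]).
* [JetchevLoefflerZerbes2021] D. Jetchev, D. Loeffler, S. L. Zerbes, *Heegner points in Coleman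
  families*, Proc. LMS 122 (2021), Thm. B (`p ∤ N′`).
* [CastellaGrossiLeeSkinner2022] Invent. Math. 227 (2022), Thm. E (tree
  `CastellaGrossiLeeSkinner2022.PConverse`).
* [SilvermanAEC2009] AEC, VII.5 (potential good reduction), X.5 (twists); Serre–Tate.
* Gross–Zagier (1986), Kolyvagin (1990): tree fact `rank_eq_analyticRank_of_analyticRank_le_one`.
* Cell records: `pub/bsd-cited/sheets/D-AUDIT-r19.md` §D (sha16 cd5ffd83ef1527f9), staged text
  `pub/bsd-cited/staging/bsd-cited-r19/KellerYinPotOrdCaseI.lean` (496a73920f7189f2),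
  `pub/pub-bsdpct` AUDIT §M5–M6 (the same scope correction, 2026-08-18), `pub/bsd-littype`
  OPEN-QUESTIONS-06 Q1.
-/

noncomputable section

open scoped Classical

open WeierstrassCurve Literature.NumberTheory.EllipticCurves
  Literature.NumberTheory.EllipticCurves.Rank1Residual

namespace Literature.NumberTheory.EllipticCurves.KellerYin2024

/-! ### The narrowed twin (Case (I)) and the remainder — claim-tagged statements -/

/-- **UNREFEREED PREPRINT — Keller–Yin, arXiv:2410.23241v1, Theorem 3.7.1 (= Thm. 0.1.2) ON THE
SCOPE OF ITS PRINTED PROOF, i.e. under §3.1 Case (I) "`f̃` has good reduction" = "`p ∤ N′`"** (the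
standing hypothesis of Thms. 3.3.5, 3.3.6, Prop. 3.4.4 and Thm. 3.5.1 through which the proof of
Thm. 3.7.1 runs; p0015 L10 "From now on, we assume `p ∤ N′`"). For `E = W/ℚ` elliptic (any model)
and a prime `p > 2`: if `E` has good ordinary reduction at some place above `p` of a number field of
degree `≤ 2` (`W.HasGoodOrdinaryReductionOverQuadraticAt p` — Case (I) for an elliptic curve:
`E` or `E^{(p*)}` good ordinary at `p`, semistability defect `e ∈ {1,2}`), `E[p]` is reducible
(`Red W p`) and `r ∈ {0,1}`, then `corank_{ℤ_p} Sel_{p^∞}(E/ℚ) = r ⟹ ord_{s=1} L(E,s) = r`. The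
binders are those of `thm012_analyticRank_eq_of_selmerCorank_eq` with
`HasPotentiallyGoodOrdinaryReductionAtPrime` REPLACED by the stronger Case-(I) predicate (which
implies it: `hasPotentiallyGoodOrdinaryReductionAtPrime_of_overQuadratic`); the twin follows from
the claim as stated (`thm371_caseI_of_thm012`). This — not `thm012_…` — is what the printed proof
supports (D-AUDIT-r19 §D.3). Nothing asserted; no `_holds` (anticyclotomic Iwasawa theory of
Heegner pairs; preprint inputs [KY24], in-proof extension of [JLZ21]).
[claim: KellerYin2024PotOrd, status: under-review] -/
def thm371_caseI_analyticRank_eq_of_selmerCorank_eq : Prop :=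
  ∀ (W : WeierstrassCurve ℚ) [W.IsElliptic] (p : ℕ) [Fact p.Prime],
    2 < p → W.HasGoodOrdinaryReductionOverQuadraticAt p → Red W p →
      ∀ r : ℕ, r = 0 ∨ r = 1 → W.selmerCorank p = r → W.analyticRank = r

/-- **The REMAINDER of Keller–Yin arXiv:2410.23241v1 Thm. 0.1.2 = 3.7.1 outside the scope of its
printed proof** — an OPEN leaf. For `E = W/ℚ` elliptic and a prime `p > 2` of potentially good
ordinary reduction (`W.HasPotentiallyGoodOrdinaryReductionAtPrime p`) that is NOT Case (I)
(`¬ W.HasGoodOrdinaryReductionOverQuadraticAt p`: no good ordinary reduction over any extension of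
`ℚ_p` of degree `≤ 2`; semistability defect `e ∈ {3,4,6}`, which forces `p ≡ 1 (mod e)`, `p ≥ 5`,
and makes the `p`-ordinary untwist `f̃` `p`-new with nebentypus `ε⁻²` of conductor `p`), with `E[p]`
reducible and `r ∈ {0,1}`: `corank_{ℤ_p} Sel_{p^∞}(E/ℚ) = r ⟹ ord_{s=1} L(E,s) = r`. CLAIMED by the
statement of Thm. 0.1.2 (p0003 L39–L45), ADDRESSED BY NO LINE OF ITS PROOF: every input from
Thm. 3.3.5 on assumes `p ∤ N′` (§3.1 p0015 L8–L10: "(JLZmain) does not cover cases (II) … From now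
on, we assume `p ∤ N′`"; Thm. 3.5.1 p0020 L23–L24), and these primes are in neither Case (I) nor
Case (II); the missing input named by the paper itself is the explicit reciprocity law
[JLZ21, Thm. B] = Prop. 3.1.2 beyond `p ∤ N′`. A REFEREE TARGET of cell `bsd-cited` (D-AUDIT-r19
§F G1; placement REQUESTS R-02); 0 consumers on 2026-08-26. NEVER cite this `Prop` as a theorem;
together with the Case-(I) twin it is equivalent to the claim as stated
(`thm012_iff_caseI_and_remainder`). [claim: KellerYin2024PotOrd, status: under-review] -/
def thm371_remainder_analyticRank_eq_of_selmerCorank_eq : Prop :=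
  ∀ (W : WeierstrassCurve ℚ) [W.IsElliptic] (p : ℕ) [Fact p.Prime],
    2 < p → W.HasPotentiallyGoodOrdinaryReductionAtPrime p →
      ¬ W.HasGoodOrdinaryReductionOverQuadraticAt p → Red W p →
        ∀ r : ℕ, r = 0 ∨ r = 1 → W.selmerCorank p = r → W.analyticRank = r

/-! ### Kernel bookkeeping: the claim as stated ⟺ its Case-(I) twin ∧ the remainder (PROVED) -/

/-- **The narrowed twin follows from the claim as stated**: Case (I) is a case of potentially good
ordinary reduction (`hasPotentiallyGoodOrdinaryReductionAtPrime_of_overQuadratic`), so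
`thm012_… ⟹ thm371_caseI_…`. [claim: KellerYin2024PotOrd, status: under-review] -/
theorem thm371_caseI_of_thm012 (h : thm012_analyticRank_eq_of_selmerCorank_eq) :
    thm371_caseI_analyticRank_eq_of_selmerCorank_eq :=
  fun W _ p _ hp hI hred r hr hcork ↦
    h W p hp (W.hasPotentiallyGoodOrdinaryReductionAtPrime_of_overQuadratic p hI) hred r hr hcork

/-- **The remainder follows from the claim as stated** (it is a slice of it).
[claim: KellerYin2024PotOrd, status: under-review] -/
theorem thm371_remainder_of_thm012 (h : thm012_analyticRank_eq_of_selmerCorank_eq) :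
    thm371_remainder_analyticRank_eq_of_selmerCorank_eq :=
  fun W _ p _ hp hpot _ hred r hr hcork ↦ h W p hp hpot hred r hr hcork

/-- **Twin ∧ remainder ⟹ the claim as stated** (case split on Case (I); classical logic only).
[claim: KellerYin2024PotOrd, status: under-review] -/
theorem thm012_of_caseI_of_remainder (h₁ : thm371_caseI_analyticRank_eq_of_selmerCorank_eq)
    (h₂ : thm371_remainder_analyticRank_eq_of_selmerCorank_eq) :
    thm012_analyticRank_eq_of_selmerCorank_eq := by
  intro W _ p _ hp hpot hred r hr hcork
  by_cases hI : W.HasGoodOrdinaryReductionOverQuadraticAt p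
  · exact h₁ W p hp hI hred r hr hcork
  · exact h₂ W p hp hpot hI hred r hr hcork

/-- **Kernel bookkeeping: Keller–Yin Thm. 0.1.2 AS STATED ⟺ (Thm. 3.7.1 on the scope of its printed
proof, Case (I)) ∧ (the remainder outside it).** Pure logic plus the tree bridge
`hasPotentiallyGoodOrdinaryReductionAtPrime_of_overQuadratic`; records exactly what the binder
narrowing of D-AUDIT-r19 sets aside. [claim: KellerYin2024PotOrd, status: under-review] -/
theorem thm012_iff_caseI_and_remainder :
    thm012_analyticRank_eq_of_selmerCorank_eq ↔
      thm371_caseI_analyticRank_eq_of_selmerCorank_eq ∧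
        thm371_remainder_analyticRank_eq_of_selmerCorank_eq :=
  ⟨fun h ↦ ⟨thm371_caseI_of_thm012 h, thm371_remainder_of_thm012 h⟩,
    fun h ↦ thm012_of_caseI_of_remainder h.1 h.2⟩

/-! ### The twin's printed consequences (the consumer API of `thm012_…`, re-pointed at Case (I)) -/

variable {W : WeierstrassCurve ℚ} {p : ℕ} [Fact p.Prime]

/-- **Thm. 3.7.1 in Case (I), full printed conclusion**: `corank_{ℤ_p} Sel_{p^∞}(E/ℚ) = r ∈ {0,1}`
gives `ord_{s=1} L(E,s) = r` (the twin) "and so `rk_ℤ E(ℚ) = r` and `#Ш(E/ℚ) < ∞`" — by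
Gross–Zagier–Kolyvagin (`hGZK`, the tree's named fact bsd.S17), exactly as
`rank_eq_and_finite_sha_of_thm012`. [claim: KellerYin2024PotOrd, status: under-review] -/
theorem rank_eq_and_finite_sha_of_thm371_caseI [W.IsElliptic]
    (h : thm371_caseI_analyticRank_eq_of_selmerCorank_eq)
    (hGZK : rank_eq_analyticRank_of_analyticRank_le_one)
    (hp : 2 < p) (hI : W.HasGoodOrdinaryReductionOverQuadraticAt p) (hred : Red W p)
    {r : ℕ} (hr : r = 0 ∨ r = 1) (hcork : W.selmerCorank p = r) :
    W.analyticRank = r ∧ W.mordellWeilRank = r ∧ Finite W.sha := by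
  have hra : W.analyticRank = r := h W p hp hI hred r hr hcork
  obtain ⟨hrk, hfin⟩ := hGZK W (by rcases hr with rfl | rfl <;> omega)
  exact ⟨hra, hrk.trans hra, hfin⟩

/-- **Case-(I) `p`-converse, rank form**: `rk_ℤ E(ℚ) = r ∈ {0,1}` and `#Ш(E/ℚ)[p^∞] < ∞` give
`corank_{ℤ_p} Sel_{p^∞}(E/ℚ) = r` (tree theorem `selmerCorank_eq_mordellWeilRank_of_finite_shaPrimary`,
Greenberg 1999 §1), whence `ord_{s=1} L(E,s) = r` by the twin.
[claim: KellerYin2024PotOrd, status: under-review] -/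
theorem analyticRank_eq_of_thm371_caseI_of_mordellWeilRank_eq [W.IsElliptic]
    (h : thm371_caseI_analyticRank_eq_of_selmerCorank_eq)
    (hp : 2 < p) (hI : W.HasGoodOrdinaryReductionOverQuadraticAt p) (hred : Red W p)
    {r : ℕ} (hr : r = 0 ∨ r = 1) (hrank : W.mordellWeilRank = r)
    (hsha : Finite (AddCommGroup.primaryComponent W.sha p)) : W.analyticRank = r :=
  h W p hp hI hred r hr ((selmerCorank_eq_mordellWeilRank_of_finite_shaPrimary W p hsha).trans hrank)

/-- **The twin at a GOOD ordinary prime** (`F = ℚ`, degree `1 ≤ 2`; tree bridge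
`hasGoodOrdinaryReductionOverQuadraticAt_of_goodOrd`): `2 < p`, `p ∤ N`, `p ∤ a_p`
(`Rank1Residual.GoodOrd`, globally minimal model), `E[p]` reducible,
`corank_{ℤ_p} Sel_{p^∞}(E/ℚ) = r ∈ {0,1}` ⇒ `ord_{s=1} L(E,s) = r` — the good ordinary Eisenstein
case ([KY24]/[CGLS]) is inside Case (I), so the narrowing costs nothing there.
[claim: KellerYin2024PotOrd, status: under-review] -/
theorem analyticRank_eq_of_thm371_caseI_of_goodOrd [W.IsElliptic] [W.IsGloballyMinimal]
    (h : thm371_caseI_analyticRank_eq_of_selmerCorank_eq)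
    (hp : 2 < p) (hord : GoodOrd W p) (hred : Red W p)
    {r : ℕ} (hr : r = 0 ∨ r = 1) (hcork : W.selmerCorank p = r) : W.analyticRank = r :=
  h W p hp (W.hasGoodOrdinaryReductionOverQuadraticAt_of_goodOrd p hord) hred r hr hcork

/-- **The twin at a good Eisenstein prime** (ordinarity automatic at `p > 2` by Serre 1972, tree
theorem `Rank1Residual.goodOrd_of_red_of_good`): `2 < p`, `p ∤ N`, `E[p]` reducible,
`corank_{ℤ_p} Sel_{p^∞}(E/ℚ) = r ∈ {0,1}` ⇒ `ord_{s=1} L(E,s) = r`.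
[claim: KellerYin2024PotOrd, status: under-review] -/
theorem analyticRank_eq_of_thm371_caseI_of_good [W.IsElliptic] [W.IsGloballyMinimal]
    (h : thm371_caseI_analyticRank_eq_of_selmerCorank_eq)
    (hp : 2 < p) (hgood : Good W p) (hred : Red W p)
    {r : ℕ} (hr : r = 0 ∨ r = 1) (hcork : W.selmerCorank p = r) : W.analyticRank = r :=
  analyticRank_eq_of_thm371_caseI_of_goodOrd h hp (goodOrd_of_red_of_good W p hp hgood hred) hred hr
    hcork

/-- **The Case-(I) twin still contains Castella–Grossi–Lee–Skinner 2022 Thm. E, case `r = 1`**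
(good Eisenstein `p > 2`; the non-anomaly hypothesis of Thm. E is simply not used): the binder
narrowing of D-AUDIT-r19 does not touch the good-reduction locus.
[claim: KellerYin2024PotOrd, status: under-review] -/
theorem thmE_one_of_thm371_caseI (h : thm371_caseI_analyticRank_eq_of_selmerCorank_eq) :
    CastellaGrossiLeeSkinner2022.thmE_analyticRank_eq_one_of_selmerCorank_eq_one := by
  intro W _ _ p _ hp hgood hred _ hcork
  exact analyticRank_eq_of_thm371_caseI_of_good h hp hgood hred (Or.inr rfl) hcork

/-- **The Case-(I) twin still contains Castella–Grossi–Lee–Skinner 2022 Thm. E, case `r = 0`.**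
[claim: KellerYin2024PotOrd, status: under-review] -/
theorem thmE_zero_of_thm371_caseI (h : thm371_caseI_analyticRank_eq_of_selmerCorank_eq) :
    CastellaGrossiLeeSkinner2022.thmE_analyticRank_eq_zero_of_selmerCorank_eq_zero := by
  intro W _ _ p _ hp hgood hred _ hcork
  exact analyticRank_eq_of_thm371_caseI_of_good h hp hgood hred (Or.inl rfl) hcork

/-- **The good-reduction half of [KY24] Theorem E (= Thm. 4.1.1 for `E/ℚ`) is contained in the
Case-(I) twin** — the re-pointing of `thmE_good_half_of_thm012` (sibling
`MultiplicativeReduction.lean`), the one by-name consumer of `thm012_…` outside its own file on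
2026-08-26 (referee C2, `pub/pub-bsdpct/REFEREE.md` ROUND 328.2(b) desk correction): it
instantiates at a GOOD Eisenstein prime, i.e. inside Case (I) (`F = ℚ`), so it factors through
the twin and the binder narrowing costs it nothing. [claim: KellerYin2024PotOrd, status: under-review] -/
theorem thmE_good_half_of_thm371_caseI (h : thm371_caseI_analyticRank_eq_of_selmerCorank_eq) :
    ∀ (W : WeierstrassCurve ℚ) [W.IsElliptic] [W.IsGloballyMinimal] (p : ℕ) [Fact p.Prime],
      2 < p → Good W p → Red W p →
        ∀ r : ℕ, r = 0 ∨ r = 1 → W.selmerCorank p = r → W.analyticRank = r :=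
  fun _ _ _ _ _ hp hgood hred _ hr hcork ↦
    analyticRank_eq_of_thm371_caseI_of_good h hp hgood hred hr hcork

/-! ### DEDUP: the typing layer's spelling of the Case-(I) twin is an ALIAS (PROVED, `Iff.rfl`) -/

/-- **DEDUP (cell `bsd-cited`, D-AUDIT-r19 ADDENDUM-2 §3, TY-QUEUE 13).** The typing layer's
spelling of Thm. 3.7.1 at the scope of its printed proof,
`thm371_pConverse_caseOne_OPEN` (sibling `PotentiallyGoodOrdinaryIwasawaTheory.lean` §7, cell
`bsd-littype`, landed two minutes before this file), and this file's narrowed twin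
`thm371_caseI_analyticRank_eq_of_selmerCorank_eq` are the SAME proposition byte for byte: same
binders `2 < p`, `W.HasGoodOrdinaryReductionOverQuadraticAt p`, `Red W p`, `r = 0 ∨ r = 1`,
`W.selmerCorank p = r`, same conclusion `W.analyticRank = r`. The two names are ALIASES of one
open statement (precedent: the two spellings of Skinner 2016 Thm. C bridged in
`Rank1Residual/Dedup.lean` §4). Consumers should cite `thm371_caseI_…` — it carries the
remainder / `thm012_iff_caseI_and_remainder` bookkeeping and the consumer API of this file —
and treat `thm371_pConverse_caseOne_OPEN` as the typing-layer alias; a referee sheet grading one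
name grades the other. Bookkeeping only; nothing asserted about either side.
[claim: KellerYin2024PotOrd, status: under-review] -/
theorem thm371_caseI_iff_caseOne_OPEN :
    thm371_caseI_analyticRank_eq_of_selmerCorank_eq ↔ thm371_pConverse_caseOne_OPEN :=
  Iff.rfl

/-- Pointed form of `thm371_caseI_iff_caseOne_OPEN`: the narrowed twin gives the typing-layer
alias. [claim: KellerYin2024PotOrd, status: under-review] -/
theorem thm371_caseOne_OPEN_of_caseI (h : thm371_caseI_analyticRank_eq_of_selmerCorank_eq) :
    thm371_pConverse_caseOne_OPEN :=
  h

/-- Pointed form of `thm371_caseI_iff_caseOne_OPEN`: the typing-layer alias gives the narrowed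
twin (so every consumer theorem of this file is available from `thm371_pConverse_caseOne_OPEN`,
e.g. `thmE_good_half_of_thm371_caseI (thm371_caseI_of_caseOne_OPEN h)`).
[claim: KellerYin2024PotOrd, status: under-review] -/
theorem thm371_caseI_of_caseOne_OPEN (h : thm371_pConverse_caseOne_OPEN) :
    thm371_caseI_analyticRank_eq_of_selmerCorank_eq :=
  h

end Literature.NumberTheory.EllipticCurves.KellerYin2024

end
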